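import Literature.NumberTheory.LFunctions.SmallGCDThirdMoment
import Literature.NumberTheory.LFunctions.LargeValuesS2AFE
import Mathlib.Analysis.Calculus.ContDiff.Convolution
import Mathlib.Analysis.Fourier.Convolution
import Mathlib.Analysis.Calculus.BumpFunction.Basic
import Mathlib.Analysis.Calculus.Deriv.Abs
import HarnessLib

/-!
# The smoothed local mean square of `R` (Guth–Maynard's `R̃`, eq. (7.5)) and its Fourier decay (Lemma 8.4)

Topic `NumberTheory/LFunctions`, family RH. Part of the programme around the tree's named fact
`Literature.NumberTheory.LFunctions.zeroDensity_guth_maynard` (L. Guth, J. Maynard, *New large value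
estimates for Dirichlet polynomials*, Ann. of Math. 203 (2026), Theorem 1.2), reduced by
`LargeValuesEnergyBound.lean` to Proposition 10.1 of the paper (§§7–10). In §§7–10 the function
`R(v) = ∑_{t∈W} |v|^{it}` (`GuthMaynardRFunction.Rfun`) enters through the smoothed local mean square
`R̃(u)² = ∫ NM ψ̃₁(NM(u−u')) ψ̃₂(u') |R(u')|² du'` (eq. (7.5)) and the function `f = ψ₁|R̃|²` of
Lemma 8.4 / Proposition 10.1. This file fixes the bumps once and for all (Mathlib's `ContDiffBump`),
DEFINES

* `psi1` (even bump, `= 1` on `[−2,2]`, supported in `(−3,3)`), `psiIn` (`= 1` on `[1/4,4]`, supported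
  in `(1/8, 33/8)`), the weight `gW W = psiIn · |R|²`, the kernel `phiB B = B·psi1(B·)` and
  **`fB W B = phiB B ⋆ gW W`**, i.e. `f_B(x) = ∫ Bψ₁(B(x−u)) ψ_in(u)|R(u)|² du = B^{-1}·R̃(x)²` with
  `B = NM` (so `f_B` is the paper's `f` of Lemma 8.4 with `ψ₂ = ψ_in`, `ψ₃ = ψ₁` and no outer cut-off),

and PROVES:

* §1–2 smoothness, support and size of the bumps and of `gW` (`gW_contDiff`, `gW_nonneg`,
  `gW_le`, `gW_eq_zero`), and the moment bounds **`∫ gW ≤ 16π ∫_{[−1,1]}|Ŵ|²`,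
  `∫ gW² ≤ 16π ∫_{[−1,1]}|Ŵ|⁴`** (`integral_gW_le`, `integral_gW_sq_le`, the substitution `u = e^{−2πτ}`),
  whence `∫ gW ≪ |W|` for `1`-separated `W` and `∫ gW² ≪ D·E(W) + D^{1−j}|W|⁴` (`integral_gW_le_card`,
  `integral_gW_sq_le_energy`: Lemmas 8.2, 8.3 of the paper via the tree's `SeparatedSums.L2_bound_sharp`,
  `GuthMaynardRFunction.L4_bound`);
* §3 `fB ≥ 0`, smooth, compactly supported in `[1/16, 17/4]` for `B ≥ 48` (`fB_nonneg`, `fB_contDiff`,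
  `hasCompactSupport_fB`, `fB_eq_zero_of_notMem`), `∫ fB = ‖ψ₁‖₁ ∫ gW` (`integral_fB`),
  `∫ fB² ≤ ‖ψ₁‖₁² ∫ gW²` (`integral_fB_sq_le`, weighted Cauchy–Schwarz), `fB ≤ B ∫ gW` (`fB_le`), and the
  lower bound `fB(x) ≥ B ∫_{|u−x|≤2/B} gW(u) du`-type domination used in §7 (`integral_indicator_le_fB`);
* §4 **Lemma 8.4 (Fourier decay of smoothenings of `R`)** in the form needed for Proposition 9.1:
  `f̂_B(ξ) = ψ̂₁(ξ/B) ĝ(ξ)` (`fourier_fB_eq`, Mathlib's `Real.fourier_mul_convolution_eq`), hence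
  `|f̂_B(ξ)| ≤ ‖ψ₁‖₁ ∫ gW` and `|f̂_B(ξ)| ≤ C_j (B/|ξ|)^j ∫ gW` (`norm_fourier_fB_le`, `norm_fourier_fB_le_decay`).
  (The paper normalises by `sup f` through the lower bound `f(1) ≳ (B/T)|W|²`; for Proposition 9.1 the
  normalisation by `∫ f = ‖ψ₁‖₁∫ gW` is what is used, and it needs no lower bound.)

No named fact is introduced; everything in this file is proved.

## References

* L. Guth, J. Maynard, *New large value estimates for Dirichlet polynomials*, Ann. of Math. (2)
  203 (2026), no. 2; arXiv:2405.20552 (2024): eq. (7.5), §8 (Lemmas 8.2, 8.3, 8.4 and their proofs),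
  §10 (the function `f = ψ₁|R̃|²`).
-/

noncomputable section

open Real Set Filter Topology Complex MeasureTheory Finset
open scoped FourierTransform ContDiff Convolution

namespace Literature.NumberTheory.LFunctions

namespace GuthMaynardSmoothR

open GuthMaynardFourier GuthMaynardRFunction

/-! ## §1. The bumps `ψ₁`, `ψ_in` -/

/-- The bump `ψ₁`: Mathlib's `ContDiffBump` at `0` with radii `2 < 3`. [cite: GuthMaynard2026, (7.5)] -/
def bump1 : ContDiffBump (0 : ℝ) := ⟨2, 3, by norm_num, by norm_num⟩

/-- `ψ₁ : ℝ → [0,1]`, smooth, `= 1` on `[−2,2]`, supported in `(−3,3)`. [cite: GuthMaynard2026, (7.5)] -/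
def psi1 : ℝ → ℝ := bump1

/-- The bump `ψ_in`: `ContDiffBump` at `17/8` with radii `15/8 < 2`. [cite: GuthMaynard2026, (7.5)] -/
def bumpIn : ContDiffBump (17 / 8 : ℝ) := ⟨15 / 8, 2, by norm_num, by norm_num⟩

/-- `ψ_in : ℝ → [0,1]`, smooth, `= 1` on `[1/4,4]`, supported in `(1/8, 33/8)`. [cite: GuthMaynard2026, (7.5)] -/
def psiIn : ℝ → ℝ := bumpIn

/-- `ψ₁` is smooth. [folklore] -/
theorem psi1_contDiff : ContDiff ℝ ∞ psi1 := bump1.contDiff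

/-- `ψ₁` has compact support. [folklore] -/
theorem psi1_hasCompactSupport : HasCompactSupport psi1 := bump1.hasCompactSupport

/-- `ψ₁ ≥ 0`. [folklore] -/
theorem psi1_nonneg (x : ℝ) : 0 ≤ psi1 x := bump1.nonneg

/-- `ψ₁ ≤ 1`. [folklore] -/
theorem psi1_le_one (x : ℝ) : psi1 x ≤ 1 := bump1.le_one

/-- `ψ₁` is continuous. [folklore] -/
theorem psi1_continuous : Continuous psi1 := bump1.continuous

/-- `ψ₁ = 1` on `[−2, 2]`. [folklore] -/
theorem psi1_eq_one {x : ℝ} (hx : |x| ≤ 2) : psi1 x = 1 := by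
  apply bump1.one_of_mem_closedBall
  rw [Metric.mem_closedBall, Real.dist_eq, sub_zero, show bump1.rIn = (2 : ℝ) from rfl]
  exact hx

/-- `ψ₁(x) ≠ 0 ⇒ |x| < 3`. [folklore] -/
theorem abs_lt_of_psi1_ne_zero {x : ℝ} (hx : psi1 x ≠ 0) : |x| < 3 := by
  have h : x ∈ Function.support (bump1 : ℝ → ℝ) := hx
  rw [bump1.support_eq, Metric.mem_ball, Real.dist_eq, sub_zero, show bump1.rOut = (3 : ℝ) from rfl] at h
  exact h

/-- `ψ_in` is smooth. [folklore] -/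
theorem psiIn_contDiff : ContDiff ℝ ∞ psiIn := bumpIn.contDiff

/-- `ψ_in` has compact support. [folklore] -/
theorem psiIn_hasCompactSupport : HasCompactSupport psiIn := bumpIn.hasCompactSupport

/-- `ψ_in ≥ 0`. [folklore] -/
theorem psiIn_nonneg (x : ℝ) : 0 ≤ psiIn x := bumpIn.nonneg

/-- `ψ_in ≤ 1`. [folklore] -/
theorem psiIn_le_one (x : ℝ) : psiIn x ≤ 1 := bumpIn.le_one

/-- `ψ_in` is continuous. [folklore] -/
theorem psiIn_continuous : Continuous psiIn := bumpIn.continuous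

/-- `ψ_in = 1` on `[1/4, 4]`. [folklore] -/
theorem psiIn_eq_one {x : ℝ} (h1 : 1 / 4 ≤ x) (h2 : x ≤ 4) : psiIn x = 1 := by
  apply bumpIn.one_of_mem_closedBall
  rw [Metric.mem_closedBall, Real.dist_eq, abs_le, show bumpIn.rIn = (15 / 8 : ℝ) from rfl]
  constructor <;> linarith

/-- `ψ_in(x) ≠ 0 ⇒ 1/8 < x < 33/8`. [folklore] -/
theorem mem_of_psiIn_ne_zero {x : ℝ} (hx : psiIn x ≠ 0) : 1 / 8 < x ∧ x < 33 / 8 := by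
  have h : x ∈ Function.support (bumpIn : ℝ → ℝ) := hx
  rw [bumpIn.support_eq, Metric.mem_ball, Real.dist_eq, abs_lt, show bumpIn.rOut = (2 : ℝ) from rfl] at h
  constructor <;> linarith [h.1, h.2]

/-- `ψ_in` is supported in `(0, ∞)`. [folklore] -/
theorem tsupport_psiIn_subset : tsupport psiIn ⊆ Set.Ioi 0 := by
  have h1 : tsupport psiIn ⊆ Set.Icc (1 / 8 : ℝ) (33 / 8) := by
    refine closure_minimal (fun x hx ↦ ?_) isClosed_Icc
    have := mem_of_psiIn_ne_zero hx
    exact ⟨this.1.le, this.2.le⟩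
  exact h1.trans fun x hx ↦ lt_of_lt_of_le (by norm_num) hx.1

/-- `‖ψ₁‖₁ = ∫ ψ₁`, a positive real. [folklore] -/
theorem integral_psi1_pos : 0 < ∫ x, psi1 x := bump1.integral_pos

/-- `ψ₁` is integrable. [folklore] -/
theorem psi1_integrable : Integrable psi1 := bump1.integrable

/-! ## §2. The weight `g_W = ψ_in |R|²` and its moments -/

/-- `g_W(u) = ψ_in(u) |R(u)|²`. [cite: GuthMaynard2026, (7.5)] -/
def gW (W : Finset ℝ) : ℝ → ℝ := fun u ↦ psiIn u * ‖Rfun W u‖ ^ 2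

/-- `g_W ≥ 0`. [folklore] -/
theorem gW_nonneg (W : Finset ℝ) (u : ℝ) : 0 ≤ gW W u := mul_nonneg (psiIn_nonneg u) (sq_nonneg _)

/-- `g_W ≤ |W|²`. [folklore] -/
theorem gW_le (W : Finset ℝ) (u : ℝ) : gW W u ≤ (W.card : ℝ) ^ 2 := by
  have h1 := psiIn_le_one u
  have h2 := norm_Rfun_le W u
  have h3 : ‖Rfun W u‖ ^ 2 ≤ (W.card : ℝ) ^ 2 := pow_le_pow_left₀ (norm_nonneg _) h2 2
  calc gW W u = psiIn u * ‖Rfun W u‖ ^ 2 := rfl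
    _ ≤ 1 * (W.card : ℝ) ^ 2 := mul_le_mul h1 h3 (sq_nonneg _) zero_le_one
    _ = _ := one_mul _

/-- `g_W(u) = 0` unless `1/8 < u < 33/8`. [folklore] -/
theorem gW_eq_zero (W : Finset ℝ) {u : ℝ} (hu : ¬(1 / 8 < u ∧ u < 33 / 8)) : gW W u = 0 := by
  have : psiIn u = 0 := by
    by_contra h; exact hu (mem_of_psiIn_ne_zero h)
  simp [gW, this]

/-- `R` is smooth away from `0`. [folklore] -/
theorem contDiffAt_Rfun (W : Finset ℝ) {u : ℝ} (hu : u ≠ 0) {n : ℕ∞} : ContDiffAt ℝ n (Rfun W) u := by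
  unfold Rfun
  refine ContDiffAt.sum fun t _ ↦ ?_
  exact (contDiffAt_ePow (abs_ne_zero.mpr hu) _).comp u (contDiffAt_abs hu)

/-- `R` is continuous away from `0`. [folklore] -/
theorem continuousAt_Rfun (W : Finset ℝ) {u : ℝ} (hu : u ≠ 0) : ContinuousAt (Rfun W) u :=
  (contDiffAt_Rfun W hu (n := 0)).continuousAt

/-- A real `C^n` function supported inside `U` times a function `C^n` on `U` is `C^n`. [folklore] -/
theorem contDiff_mul_of_tsupport_real {Φ g : ℝ → ℝ} {U : Set ℝ} {n : WithTop ℕ∞}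
    (hΦ : ContDiff ℝ n Φ) (hsupp : tsupport Φ ⊆ U) (hg : ∀ x ∈ U, ContDiffAt ℝ n g x) :
    ContDiff ℝ n (fun x ↦ Φ x * g x) := by
  rw [contDiff_iff_contDiffAt]
  intro x
  by_cases hx : x ∈ U
  · exact hΦ.contDiffAt.mul (hg x hx)
  · have hx' : x ∉ tsupport Φ := fun h ↦ hx (hsupp h)
    have h0 : Φ =ᶠ[𝓝 x] 0 := notMem_tsupport_iff_eventuallyEq.mp hx'
    have h1 : (fun x ↦ Φ x * g x) =ᶠ[𝓝 x] (fun _ ↦ (0 : ℝ)) :=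
      h0.mono fun y hy ↦ by simp [hy]
    exact (contDiffAt_const (c := (0 : ℝ))).congr_of_eventuallyEq h1

/-- `g_W` is smooth. [folklore] -/
theorem gW_contDiff (W : Finset ℝ) : ContDiff ℝ ∞ (gW W) := by
  unfold gW
  refine contDiff_mul_of_tsupport_real psiIn_contDiff tsupport_psiIn_subset fun x hx ↦ ?_
  exact (contDiffAt_Rfun W (ne_of_gt hx)).norm_sq (𝕜 := ℂ)

/-- `g_W` is continuous. [folklore] -/
theorem gW_continuous (W : Finset ℝ) : Continuous (gW W) := (gW_contDiff W).continuous

/-- `g_W` has compact support. [folklore] -/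
theorem hasCompactSupport_gW (W : Finset ℝ) : HasCompactSupport (gW W) := by
  refine HasCompactSupport.of_support_subset_isCompact (K := Set.Icc (1 / 8 : ℝ) (33 / 8)) isCompact_Icc
    fun u hu ↦ ?_
  by_contra h
  rw [Set.mem_Icc, not_and_or] at h
  apply hu
  apply gW_eq_zero
  rintro ⟨h1, h2⟩
  rcases h with h | h
  · exact h h1.le
  · exact h h2.le

/-- `g_W` is integrable. [folklore] -/
theorem gW_integrable (W : Finset ℝ) : Integrable (gW W) :=
  (gW_continuous W).integrable_of_hasCompactSupport (hasCompactSupport_gW W)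

/-- `g_W²` has compact support. [folklore] -/
theorem hasCompactSupport_gW_sq (W : Finset ℝ) : HasCompactSupport (fun u ↦ gW W u ^ 2) :=
  (hasCompactSupport_gW W).comp_left (g := fun y : ℝ ↦ y ^ 2) (by simp)

/-- `g_W²` is integrable. [folklore] -/
theorem gW_sq_integrable (W : Finset ℝ) : Integrable (fun u ↦ gW W u ^ 2) :=
  ((gW_continuous W).pow 2).integrable_of_hasCompactSupport (hasCompactSupport_gW_sq W)

/-- **The substitution `u = e^{−2πτ}`**: for a continuous `ψ : ℝ → [0,1]` vanishing off `(1/8, 33/8)`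
and `k ≥ 0`, `∫ ψ(u)|R(u)|^k du ≤ 16π ∫_{[−1,1]} |Ŵ(τ)|^k dτ` (`R(e^{−2πτ}) = Ŵ(τ)`, the Jacobian is
`2πe^{−2πτ} ≤ 16π` and `|τ| < 1` on the support). [cite: GuthMaynard2026, proof of Lemma 8.2] -/
theorem integral_weight_le (W : Finset ℝ) {ψ : ℝ → ℝ} (hψc : Continuous ψ) (hψ0 : ∀ u, 0 ≤ ψ u)
    (hψ1 : ∀ u, ψ u ≤ 1) (hψs : ∀ u, ψ u ≠ 0 → 1 / 8 < u ∧ u < 33 / 8) (k : ℕ) :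
    ∫ u, ψ u * ‖Rfun W u‖ ^ k ≤ 16 * π * ∫ τ in Set.Icc (-1 : ℝ) 1, ‖trigPoly W τ‖ ^ k := by
  -- restrict to `u > 0` and substitute
  set h : ℝ → ℝ := fun u ↦ ψ u * ‖Rfun W u‖ ^ k with hh
  have h1 : ∫ u, h u = ∫ u in Set.Ioi 0, h u := by
    rw [setIntegral_eq_integral_of_forall_compl_eq_zero]
    intro u hu
    have : ψ u = 0 := by
      by_contra h'; exact hu (lt_trans (by norm_num) (hψs u h').1)
    simp [hh, this]
  set e : ℝ → ℝ := fun τ ↦ Real.exp (-(2 * π * τ)) with he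
  have he' : ∀ τ, HasDerivAt e (-(2 * π) * Real.exp (-(2 * π * τ))) τ := by
    intro τ
    have h : HasDerivAt (fun x : ℝ ↦ -(2 * π * x)) (-(2 * π)) τ := by
      have h0 : HasDerivAt (fun x : ℝ ↦ 2 * π * x) (2 * π) τ := by
        simpa using (hasDerivAt_id τ).const_mul (2 * π)
      exact h0.neg
    have h2 := h.exp
    simp only [he]
    convert h2 using 1
    ring
  have hinj : Set.InjOn e Set.univ := by
    intro a _ b _ hab
    simp only [he] at hab
    have := Real.exp_injective hab
    have hπ := Real.pi_pos
    nlinarith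
  have himage : e '' Set.univ = Set.Ioi 0 := by
    ext u
    simp only [Set.image_univ, Set.mem_range, Set.mem_Ioi, he]
    constructor
    · rintro ⟨τ, rfl⟩; exact Real.exp_pos _
    · intro hu
      refine ⟨-(Real.log u) / (2 * π), ?_⟩
      have hπ : (π : ℝ) ≠ 0 := Real.pi_pos.ne'
      rw [show -(2 * π * (-Real.log u / (2 * π))) = Real.log u by field_simp, Real.exp_log hu]
  have h2 : ∫ u in Set.Ioi 0, h u = ∫ τ, |(-(2 * π) * Real.exp (-(2 * π * τ)))| * h (e τ) := by
    rw [← himage, integral_image_eq_integral_abs_deriv_smul MeasurableSet.univ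
      (fun τ _ ↦ (he' τ).hasDerivWithinAt) hinj, Measure.restrict_univ]
    rfl
  -- the transformed integrand is dominated by `16π · 1_{[−1,1]} |Ŵ|^k`
  have hR : ∀ τ, Rfun W (e τ) = trigPoly W τ := by
    intro τ
    rw [Rfun_eq_trigPoly, he]
    simp only [abs_of_pos (Real.exp_pos _), Real.log_exp]
    congr 1
    have hπ : (π : ℝ) ≠ 0 := Real.pi_pos.ne'
    field_simp
  have hdom : ∀ τ, |(-(2 * π) * Real.exp (-(2 * π * τ)))| * h (e τ) ≤
      (Set.Icc (-1 : ℝ) 1).indicator (fun τ ↦ 16 * π * ‖trigPoly W τ‖ ^ k) τ := by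
    intro τ
    simp only [hh, hR]
    by_cases hψτ : ψ (e τ) = 0
    · rw [hψτ]; simp only [zero_mul, mul_zero]
      exact Set.indicator_nonneg (fun _ _ ↦ by positivity) _
    · obtain ⟨hl, hu⟩ := hψs _ hψτ
      simp only [he] at hl hu
      -- `|τ| < 1`
      have hτ : τ ∈ Set.Icc (-1 : ℝ) 1 := by
        have hl' : Real.log (1 / 8) < -(2 * π * τ) := by
          rw [← Real.exp_lt_exp, Real.exp_log (by norm_num)]; exact hl
        have hu' : -(2 * π * τ) < Real.log (33 / 8) := by
          rw [← Real.exp_lt_exp, Real.exp_log (by norm_num)]; exact hu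
        have hlog8 : Real.log 8 < 21 / 10 := by
          rw [show (8 : ℝ) = 2 ^ 3 by norm_num, Real.log_pow]
          have := Real.log_two_lt_d9
          norm_num at this ⊢
          linarith
        have hlog1 : Real.log (33 / 8) < 21 / 10 :=
          lt_of_le_of_lt (Real.log_le_log (by norm_num) (by norm_num)) hlog8
        have hlog2 : -(21 / 10) < Real.log (1 / 8) := by
          rw [one_div, Real.log_inv]; linarith
        have hπ3 : 3 < π := Real.pi_gt_three
        constructor
        · by_contra hc; push Not at hc; nlinarith
        · by_contra hc; push Not at hc; nlinarith
      rw [Set.indicator_of_mem hτ]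
      have hexp : Real.exp (-(2 * π * τ)) ≤ 8 := by linarith
      have habs : |(-(2 * π) * Real.exp (-(2 * π * τ)))| = 2 * π * Real.exp (-(2 * π * τ)) := by
        rw [abs_mul, abs_neg, abs_of_pos (by positivity), abs_of_pos (Real.exp_pos _)]
      rw [habs]
      have hψle := hψ1 (Real.exp (-(2 * π * τ)))
      have hψge := hψ0 (Real.exp (-(2 * π * τ)))
      have hW0 : 0 ≤ ‖trigPoly W τ‖ ^ k := by positivity
      have hπ0 : 0 < π := Real.pi_pos
      calc 2 * π * Real.exp (-(2 * π * τ)) * (ψ (Real.exp (-(2 * π * τ))) * ‖trigPoly W τ‖ ^ k)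
          ≤ 2 * π * 8 * (1 * ‖trigPoly W τ‖ ^ k) := by gcongr
        _ = 16 * π * ‖trigPoly W τ‖ ^ k := by ring
  -- integrability of both sides
  have hcontW : Continuous (trigPoly W) := by
    unfold trigPoly; refine continuous_finsetSum _ fun t _ ↦ ?_; fun_prop
  have hint2 : Integrable ((Set.Icc (-1 : ℝ) 1).indicator (fun τ ↦ 16 * π * ‖trigPoly W τ‖ ^ k)) := by
    rw [integrable_indicator_iff measurableSet_Icc]
    exact (by fun_prop : Continuous fun τ ↦ 16 * π * ‖trigPoly W τ‖ ^ k).integrableOn_Icc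
  have hint1 : Integrable (fun τ ↦ |(-(2 * π) * Real.exp (-(2 * π * τ)))| * h (e τ)) := by
    refine Integrable.mono' hint2 ?_ (Eventually.of_forall fun τ ↦ ?_)
    · have hc : Continuous fun τ ↦ |(-(2 * π) * Real.exp (-(2 * π * τ)))| * h (e τ) := by
        simp only [hh, hR]
        have h3 : Continuous fun τ ↦ ψ (e τ) := hψc.comp (by simp only [he]; fun_prop)
        fun_prop
      exact hc.aestronglyMeasurable
    · rw [Real.norm_of_nonneg (mul_nonneg (abs_nonneg _) (by simp only [hh]; exact mul_nonneg (hψ0 _) (by positivity)))]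
      exact hdom τ
  rw [h1, h2]
  calc ∫ τ, |(-(2 * π) * Real.exp (-(2 * π * τ)))| * h (e τ)
      ≤ ∫ τ, (Set.Icc (-1 : ℝ) 1).indicator (fun τ ↦ 16 * π * ‖trigPoly W τ‖ ^ k) τ :=
        integral_mono hint1 hint2 hdom
    _ = ∫ τ in Set.Icc (-1 : ℝ) 1, 16 * π * ‖trigPoly W τ‖ ^ k := integral_indicator measurableSet_Icc
    _ = 16 * π * ∫ τ in Set.Icc (-1 : ℝ) 1, ‖trigPoly W τ‖ ^ k := by rw [integral_const_mul]

/-- **`∫ g_W ≤ 16π ∫_{[−1,1]} |Ŵ|²`**. [cite: GuthMaynard2026, Lemma 8.2] -/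
theorem integral_gW_le (W : Finset ℝ) : ∫ u, gW W u ≤ 16 * π * ∫ τ in Set.Icc (-1 : ℝ) 1, ‖trigPoly W τ‖ ^ 2 :=
  integral_weight_le W psiIn_continuous psiIn_nonneg psiIn_le_one (fun _ h ↦ mem_of_psiIn_ne_zero h) 2

/-- **`∫ g_W² ≤ 16π ∫_{[−1,1]} |Ŵ|⁴`**. [cite: GuthMaynard2026, Lemma 8.3] -/
theorem integral_gW_sq_le (W : Finset ℝ) :
    ∫ u, gW W u ^ 2 ≤ 16 * π * ∫ τ in Set.Icc (-1 : ℝ) 1, ‖trigPoly W τ‖ ^ 4 := by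
  have h := integral_weight_le W (ψ := fun u ↦ psiIn u ^ 2) (psiIn_continuous.pow 2)
    (fun u ↦ sq_nonneg _) (fun u ↦ by
      have := psiIn_le_one u; have := psiIn_nonneg u; nlinarith)
    (fun u hu ↦ mem_of_psiIn_ne_zero (by intro h0; apply hu; simp [h0])) 4
  refine le_trans (le_of_eq ?_) h
  refine integral_congr_ae (Eventually.of_forall fun u ↦ ?_)
  simp only [gW]; ring

/-- **Lemma 8.2 in `u`-space**: `∫ g_W ≤ C |W|` for finite `1`-separated `W` (an absolute `C`).
[cite: GuthMaynard2026, Lemma 8.2] -/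
theorem integral_gW_le_card : ∃ C, 0 ≤ C ∧ ∀ (W : Finset ℝ),
    (∀ t ∈ W, ∀ t' ∈ W, t ≠ t' → 1 ≤ |t - t'|) → ∫ u, gW W u ≤ C * W.card := by
  obtain ⟨Φ, hΦ, hΦs, hΦ0, hΦ1⟩ := GuthMaynardSmallGCD.exists_symmBump
  have hΦc : ContDiff ℝ ∞ (fun y ↦ (Φ y : ℂ)) := Complex.ofRealCLM.contDiff.comp hΦ
  have hΦcs : HasCompactSupport (fun y ↦ (Φ y : ℂ)) := hΦs.comp_left Complex.ofReal_zero
  obtain ⟨C₂, hC₂0, hC₂⟩ := SeparatedSums.L2_bound_sharp hΦc hΦcs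
  refine ⟨16 * π * (2 * C₂), by positivity, fun W hsep ↦ ?_⟩
  have h1 := integral_gW_le W
  have h2 : ∫ τ in Set.Icc (-1 : ℝ) 1, ‖trigPoly W τ‖ ^ 2 ≤ 2 * C₂ * W.card := by
    have := GuthMaynardSmallGCD.setIntegral_le_smoothed hΦ hΦs hΦ0 hΦ1 le_rfl W 2
    simp only [div_one] at this
    refine this.trans ((hC₂ W 1 one_pos hsep).trans (le_of_eq ?_))
    ring
  have hπ := Real.pi_pos
  calc ∫ u, gW W u ≤ 16 * π * ∫ τ in Set.Icc (-1 : ℝ) 1, ‖trigPoly W τ‖ ^ 2 := h1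
    _ ≤ 16 * π * (2 * C₂ * W.card) := by gcongr
    _ = _ := by ring

/-- **Lemma 8.3 in `u`-space**: for every `j` there is `C` with
`∫ g_W² ≤ C D E(W) + C D^{1−j}|W|⁴` for all finite `W` and `D ≥ 1` (`E(W)` the additive energy count).
[cite: GuthMaynard2026, Lemma 8.3] -/
theorem integral_gW_sq_le_energy (j : ℕ) : ∃ C, 0 ≤ C ∧ ∀ (W : Finset ℝ) (D : ℝ), 1 ≤ D →
    ∫ u, gW W u ^ 2 ≤ C * D * ((((W ×ˢ W) ×ˢ (W ×ˢ W)).filter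
        (fun q : (ℝ × ℝ) × (ℝ × ℝ) ↦ |q.1.1 + q.1.2 - q.2.1 - q.2.2| ≤ 1)).card : ℝ) +
      C * D / D ^ j * (W.card : ℝ) ^ 4 := by
  obtain ⟨Φ, hΦ, hΦs, hΦ0, hΦ1⟩ := GuthMaynardSmallGCD.exists_symmBump
  have hΦc : ContDiff ℝ ∞ (fun y ↦ (Φ y : ℂ)) := Complex.ofRealCLM.contDiff.comp hΦ
  have hΦcs : HasCompactSupport (fun y ↦ (Φ y : ℂ)) := hΦs.comp_left Complex.ofReal_zero
  obtain ⟨C₄, hC₄0, hC₄⟩ := L4_bound hΦc hΦcs j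
  refine ⟨16 * π * C₄, by positivity, fun W D hD ↦ ?_⟩
  have h1 := integral_gW_sq_le W
  have h2 := (GuthMaynardSmallGCD.setIntegral_le_smoothed hΦ hΦs hΦ0 hΦ1 hD W 4).trans (hC₄ W D hD)
  have hπ := Real.pi_pos
  calc ∫ u, gW W u ^ 2 ≤ 16 * π * ∫ τ in Set.Icc (-1 : ℝ) 1, ‖trigPoly W τ‖ ^ 4 := h1
    _ ≤ 16 * π * (C₄ * D * ((((W ×ˢ W) ×ˢ (W ×ˢ W)).filter
        (fun q : (ℝ × ℝ) × (ℝ × ℝ) ↦ |q.1.1 + q.1.2 - q.2.1 - q.2.2| ≤ 1)).card : ℝ) +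
          C₄ * D / D ^ j * (W.card : ℝ) ^ 4) := by gcongr
    _ = _ := by ring

/-! ## §3. The kernel `φ_B = Bψ₁(B·)` and the smoothed mean square `f_B = φ_B ⋆ g_W` -/

/-- The kernel `φ_B(y) = B ψ₁(By)` (an approximate identity at scale `1/B`, up to the factor `‖ψ₁‖₁`).
[cite: GuthMaynard2026, (7.5)] -/
def phiB (B : ℝ) : ℝ → ℝ := fun y ↦ B * psi1 (B * y)

/-- **`f_B = φ_B ⋆ g_W`**, i.e. `f_B(x) = ∫ Bψ₁(B(x−u)) ψ_in(u) |R(u)|² du` (`= B^{-1}R̃(x)²` for `B = NM`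
in the notation of eq. (7.5); the function `f` of Lemma 8.4 and Proposition 10.1).
[cite: GuthMaynard2026, (7.5) and Lemma 8.4] -/
def fB (W : Finset ℝ) (B : ℝ) : ℝ → ℝ := phiB B ⋆ gW W

section kernel

variable {B : ℝ}

/-- `φ_B` is smooth. [folklore] -/
theorem phiB_contDiff (B : ℝ) : ContDiff ℝ ∞ (phiB B) := by
  unfold phiB
  exact contDiff_const.mul (psi1_contDiff.comp (contDiff_const.mul contDiff_id))

/-- `φ_B` is continuous. [folklore] -/
theorem phiB_continuous (B : ℝ) : Continuous (phiB B) := (phiB_contDiff B).continuous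

/-- `φ_B ≥ 0` (`B ≥ 0`). [folklore] -/
theorem phiB_nonneg (hB : 0 ≤ B) (y : ℝ) : 0 ≤ phiB B y := mul_nonneg hB (psi1_nonneg _)

/-- `φ_B ≤ B` (`B ≥ 0`). [folklore] -/
theorem phiB_le (hB : 0 ≤ B) (y : ℝ) : phiB B y ≤ B :=
  (mul_le_mul_of_nonneg_left (psi1_le_one _) hB).trans (le_of_eq (mul_one B))

/-- `φ_B(y) ≠ 0 ⇒ |y| < 3/B`. [folklore] -/
theorem abs_lt_of_phiB_ne_zero (hB : 0 < B) {y : ℝ} (hy : phiB B y ≠ 0) : |y| < 3 / B := by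
  have h : psi1 (B * y) ≠ 0 := by
    intro h; apply hy; simp [phiB, h]
  have := abs_lt_of_psi1_ne_zero h
  rw [abs_mul, abs_of_pos hB] at this
  rw [lt_div_iff₀ hB]; linarith

/-- `φ_B(y) = B` for `|y| ≤ 2/B`. [folklore] -/
theorem phiB_eq (hB : 0 < B) {y : ℝ} (hy : |y| ≤ 2 / B) : phiB B y = B := by
  have : psi1 (B * y) = 1 := by
    apply psi1_eq_one
    rw [abs_mul, abs_of_pos hB]
    rwa [le_div_iff₀' hB] at hy
  simp [phiB, this]

/-- `φ_B` has compact support (`B > 0`). [folklore] -/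
theorem hasCompactSupport_phiB (hB : 0 < B) : HasCompactSupport (phiB B) := by
  refine HasCompactSupport.of_support_subset_isCompact (K := Set.Icc (-(3 / B)) (3 / B)) isCompact_Icc
    fun y hy ↦ ?_
  have := abs_lt_of_phiB_ne_zero hB hy
  rw [abs_lt] at this
  exact ⟨this.1.le, this.2.le⟩

/-- `φ_B` is integrable (`B > 0`). [folklore] -/
theorem phiB_integrable (hB : 0 < B) : Integrable (phiB B) :=
  (phiB_continuous B).integrable_of_hasCompactSupport (hasCompactSupport_phiB hB)

/-- `∫ φ_B = ∫ ψ₁` (`B > 0`). [folklore] -/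
theorem integral_phiB (hB : 0 < B) : ∫ y, phiB B y = ∫ x, psi1 x := by
  unfold phiB
  rw [integral_const_mul, Measure.integral_comp_mul_left psi1 B, smul_eq_mul, ← mul_assoc, abs_inv,
    abs_of_pos hB, mul_inv_cancel₀ hB.ne', one_mul]

end kernel

section smooth

variable (W : Finset ℝ) {B : ℝ}

/-- `f_B(x) = ∫ φ_B(x−u) g_W(u) du`. [cite: GuthMaynard2026, (7.5)] -/
theorem fB_apply (B x : ℝ) : fB W B x = ∫ u, phiB B (x - u) * gW W u := by
  rw [fB, convolution_eq_swap]
  rfl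

/-- `f_B ≥ 0` (`B ≥ 0`). [folklore] -/
theorem fB_nonneg (hB : 0 ≤ B) (x : ℝ) : 0 ≤ fB W B x := by
  rw [fB_apply]
  exact integral_nonneg fun u ↦ mul_nonneg (phiB_nonneg hB _) (gW_nonneg W u)

/-- `f_B` is smooth (`B > 0`). [cite: GuthMaynard2026, Lemma 8.4] -/
theorem fB_contDiff (hB : 0 < B) : ContDiff ℝ ∞ (fB W B) :=
  (hasCompactSupport_phiB hB).contDiff_convolution_left _ (phiB_contDiff B)
    (gW_integrable W).locallyIntegrable

/-- `f_B` is continuous (`B > 0`). [folklore] -/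
theorem fB_continuous (hB : 0 < B) : Continuous (fB W B) := (fB_contDiff W hB).continuous

/-- `f_B` has compact support (`B > 0`). [folklore] -/
theorem hasCompactSupport_fB (hB : 0 < B) : HasCompactSupport (fB W B) :=
  (hasCompactSupport_phiB hB).convolution _ (hasCompactSupport_gW W)

/-- `f_B(x) = 0` unless `1/8 − 3/B < x < 33/8 + 3/B`; in particular `f_B` is supported in `[1/16, 17/4]`
for `B ≥ 48`. [folklore] -/
theorem fB_eq_zero_of_notMem (hB : 0 < B) {x : ℝ} (hx : ¬(1 / 8 - 3 / B < x ∧ x < 33 / 8 + 3 / B)) :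
    fB W B x = 0 := by
  rw [fB_apply]
  refine integral_eq_zero_of_ae (Eventually.of_forall fun u ↦ ?_)
  simp only [Pi.zero_apply]
  by_cases hg : gW W u = 0
  · rw [hg, mul_zero]
  · have hu : 1 / 8 < u ∧ u < 33 / 8 := by
      by_contra h; exact hg (gW_eq_zero W h)
    have hφ : phiB B (x - u) = 0 := by
      by_contra h
      have := abs_lt_of_phiB_ne_zero hB h
      rw [abs_lt] at this
      apply hx
      constructor <;> linarith [this.1, this.2]
    rw [hφ, zero_mul]

/-- `f_B` is integrable (`B > 0`). [folklore] -/
theorem fB_integrable (hB : 0 < B) : Integrable (fB W B) :=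
  (fB_continuous W hB).integrable_of_hasCompactSupport (hasCompactSupport_fB W hB)

/-- **`∫ f_B = ‖ψ₁‖₁ ∫ g_W`**. [cite: GuthMaynard2026, proof of Proposition 9.1] -/
theorem integral_fB (hB : 0 < B) : ∫ x, fB W B x = (∫ x, psi1 x) * ∫ u, gW W u := by
  rw [fB, integral_convolution _ (phiB_integrable hB) (gW_integrable W), ContinuousLinearMap.lsmul_apply,
    smul_eq_mul, integral_phiB hB]

/-- `f_B ≤ B ∫ g_W` pointwise (`B ≥ 0`). [folklore] -/
theorem fB_le (hB : 0 < B) (x : ℝ) : fB W B x ≤ B * ∫ u, gW W u := by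
  rw [fB_apply, ← integral_const_mul]
  refine integral_mono_of_nonneg (Eventually.of_forall fun u ↦ mul_nonneg (phiB_nonneg hB.le _) (gW_nonneg W u))
    ((gW_integrable W).const_mul B) (Eventually.of_forall fun u ↦ ?_)
  exact mul_le_mul_of_nonneg_right (phiB_le hB.le _) (gW_nonneg W u)

/-- **Domination of a local integral by `f_B`**: `B ∫_{|u−x| ≤ 2/B} g_W(u) du ≤ f_B(x)` (since
`φ_B(x−u) = B` there). This is how `f_B` majorises the localised `v₂`-integrals of §7.
[cite: GuthMaynard2026, proof of Proposition 7.2] -/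
theorem integral_indicator_le_fB (hB : 0 < B) (x : ℝ) :
    B * ∫ u in Set.Icc (x - 2 / B) (x + 2 / B), gW W u ≤ fB W B x := by
  rw [fB_apply, ← integral_indicator measurableSet_Icc, ← integral_const_mul]
  refine integral_mono_of_nonneg (Eventually.of_forall fun u ↦ ?_) ?_ (Eventually.of_forall fun u ↦ ?_)
  · exact mul_nonneg hB.le (Set.indicator_nonneg (fun _ _ ↦ gW_nonneg W _) _)
  · exact (((phiB_continuous B).comp (continuous_const.sub continuous_id)).mul (gW_continuous W)).integrable_of_hasCompactSupport
      ((hasCompactSupport_gW W).mul_left)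
  · simp only
    by_cases hu : u ∈ Set.Icc (x - 2 / B) (x + 2 / B)
    · rw [Set.indicator_of_mem hu]
      have : phiB B (x - u) = B := by
        apply phiB_eq hB
        rw [Set.mem_Icc] at hu
        rw [abs_le]; constructor <;> linarith
      rw [this]
    · rw [Set.indicator_of_notMem hu, mul_zero]
      exact mul_nonneg (phiB_nonneg hB.le _) (gW_nonneg W u)

/-- **`∫ f_B² ≤ ‖ψ₁‖₁² ∫ g_W²`** (Cauchy–Schwarz in the `u`-integral with the weight `φ_B(x−u)`, then
Fubini). [cite: GuthMaynard2026, proof of Proposition 9.1] -/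
theorem integral_fB_sq_le (hB : 0 < B) : ∫ x, fB W B x ^ 2 ≤ (∫ x, psi1 x) ^ 2 * ∫ u, gW W u ^ 2 := by
  set I₁ : ℝ := ∫ x, psi1 x with hI₁
  -- pointwise Cauchy–Schwarz: `f_B(x)² ≤ ‖ψ₁‖₁ · (φ_B ⋆ g_W²)(x)`
  have hpt : ∀ x, fB W B x ^ 2 ≤ I₁ * ∫ u, phiB B (x - u) * gW W u ^ 2 := by
    intro x
    rw [fB_apply]
    have hφi : Integrable (fun u ↦ phiB B (x - u)) := (phiB_integrable hB).comp_sub_left x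
    have h := GuthMaynardS2.sq_integral_mul_le (f := fun u ↦ phiB B (x - u)) (g := gW W)
      (fun u ↦ phiB_nonneg hB.le _) (gW_nonneg W) hφi (gW_continuous W).aestronglyMeasurable
      ((((phiB_continuous B).comp (continuous_const.sub continuous_id)).mul ((gW_continuous W).pow 2)).integrable_of_hasCompactSupport
        (hasCompactSupport_gW_sq W).mul_left)
    have hφint : ∫ u, phiB B (x - u) = I₁ := by
      rw [integral_sub_left_eq_self (phiB B) volume x, integral_phiB hB]
    rw [hφint] at h
    exact h
  -- integrate: `∫ (φ_B ⋆ g_W²) = ‖ψ₁‖₁ ∫ g_W²`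
  have hconv : ∀ x, ∫ u, phiB B (x - u) * gW W u ^ 2 = (phiB B ⋆ fun u ↦ gW W u ^ 2) x := by
    intro x; rw [convolution_eq_swap]; rfl
  have hint : ∫ x, (phiB B ⋆ fun u ↦ gW W u ^ 2) x = I₁ * ∫ u, gW W u ^ 2 := by
    rw [integral_convolution _ (phiB_integrable hB) (gW_sq_integrable W), ContinuousLinearMap.lsmul_apply,
      smul_eq_mul, integral_phiB hB]
  have hci : Integrable (phiB B ⋆ fun u ↦ gW W u ^ 2) := by
    have hc : Continuous (phiB B ⋆ fun u ↦ gW W u ^ 2) :=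
      (hasCompactSupport_phiB hB).continuous_convolution_left _ (phiB_continuous B)
        (gW_sq_integrable W).locallyIntegrable
    exact hc.integrable_of_hasCompactSupport ((hasCompactSupport_phiB hB).convolution _ (hasCompactSupport_gW_sq W))
  calc ∫ x, fB W B x ^ 2 ≤ ∫ x, I₁ * (phiB B ⋆ fun u ↦ gW W u ^ 2) x := by
        refine integral_mono_of_nonneg (Eventually.of_forall fun x ↦ sq_nonneg _) (hci.const_mul I₁)
          (Eventually.of_forall fun x ↦ ?_)
        simp only
        rw [← hconv]; exact hpt x
    _ = I₁ * (I₁ * ∫ u, gW W u ^ 2) := by rw [integral_const_mul, hint]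
    _ = I₁ ^ 2 * ∫ u, gW W u ^ 2 := by ring

end smooth

/-! ## §4. Lemma 8.4: the Fourier transform of `f_B` -/

section fourier

variable (W : Finset ℝ) {B : ℝ}

/-- `𝓕(a·f) = a·𝓕f`. [folklore] -/
theorem fourier_const_mul (a : ℂ) (f : ℝ → ℂ) (ξ : ℝ) : 𝓕 (fun y ↦ a * f y) ξ = a * 𝓕 f ξ := by
  rw [Real.fourier_real_eq, Real.fourier_real_eq, ← integral_const_mul]
  refine integral_congr_ae (Eventually.of_forall fun v ↦ ?_)
  simp only [Circle.smul_def, smul_eq_mul]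
  ring

/-- `f_B` as a complex function is the convolution (for multiplication) of the complexified kernel and
weight. [folklore] -/
theorem fB_ofReal_eq (B : ℝ) :
    (fun x ↦ ((fB W B x : ℝ) : ℂ)) =
      (fun y ↦ ((phiB B y : ℝ) : ℂ)) ⋆[ContinuousLinearMap.mul ℂ ℂ] (fun u ↦ ((gW W u : ℝ) : ℂ)) := by
  ext x
  rw [fB, convolution_def, convolution_def, ← integral_complex_ofReal]
  refine integral_congr_ae (Eventually.of_forall fun t ↦ ?_)
  simp only [ContinuousLinearMap.lsmul_apply, smul_eq_mul, ContinuousLinearMap.mul_apply']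
  push_cast
  rfl

/-- `φ̂_B(ξ) = ψ̂₁(ξ/B)` (`B > 0`). [folklore] -/
theorem fourier_phiB (hB : 0 < B) (ξ : ℝ) :
    𝓕 (fun y ↦ ((phiB B y : ℝ) : ℂ)) ξ = 𝓕 (fun x ↦ ((psi1 x : ℝ) : ℂ)) (ξ / B) := by
  have h := fourier_comp_div (fun x ↦ ((psi1 x : ℝ) : ℂ)) (inv_pos.mpr hB) ξ
  have e : (fun y : ℝ ↦ ((phiB B y : ℝ) : ℂ)) = fun y ↦ (B : ℂ) * ((psi1 (y / B⁻¹) : ℝ) : ℂ) := by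
    ext y
    simp only [phiB, div_inv_eq_mul, mul_comm y B]
    push_cast
    ring
  rw [e, fourier_const_mul, h, ← mul_assoc]
  have e2 : (B : ℂ) * ((B⁻¹ : ℝ) : ℂ) = 1 := by
    push_cast
    exact mul_inv_cancel₀ (by exact_mod_cast hB.ne')
  rw [e2, one_mul, inv_mul_eq_div]

/-- The complexified kernel and weight are integrable. [folklore] -/
theorem phiB_integrable_ofReal (hB : 0 < B) : Integrable (fun y ↦ ((phiB B y : ℝ) : ℂ)) :=
  (phiB_integrable hB).ofReal

/-- The complexified weight is integrable. [folklore] -/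
theorem gW_integrable_ofReal : Integrable (fun u ↦ ((gW W u : ℝ) : ℂ)) := (gW_integrable W).ofReal

/-- **`f̂_B(ξ) = ψ̂₁(ξ/B) ĝ_W(ξ)`** ("`f₁` is a convolution of `Bψ₃(Bu)` and `g(u)`, so has Fourier
transform `ψ̂₃(ξ/B)ĝ(ξ)`"). [cite: GuthMaynard2026, proof of Lemma 8.4] -/
theorem fourier_fB_eq (hB : 0 < B) (ξ : ℝ) :
    𝓕 (fun x ↦ ((fB W B x : ℝ) : ℂ)) ξ =
      𝓕 (fun x ↦ ((psi1 x : ℝ) : ℂ)) (ξ / B) * 𝓕 (fun u ↦ ((gW W u : ℝ) : ℂ)) ξ := by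
  rw [fB_ofReal_eq W B, Real.fourier_mul_convolution_eq (phiB_integrable_ofReal hB) (gW_integrable_ofReal W),
    fourier_phiB hB]

/-- `|ĝ_W(ξ)| ≤ ∫ g_W` ("`ĝ(ξ) ≪ |W|²`" in the paper; here normalised by `‖g‖₁`). [cite: GuthMaynard2026, proof of Lemma 8.4] -/
theorem norm_fourier_gW_le (ξ : ℝ) : ‖𝓕 (fun u ↦ ((gW W u : ℝ) : ℂ)) ξ‖ ≤ ∫ u, gW W u := by
  refine (norm_fourier_le_integral_norm _ _).trans (le_of_eq ?_)
  refine integral_congr_ae (Eventually.of_forall fun u ↦ ?_)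
  simp only [Complex.norm_real, Real.norm_eq_abs, abs_of_nonneg (gW_nonneg W u)]

/-- `|ψ̂₁(η)| ≤ ‖ψ₁‖₁`. [folklore] -/
theorem norm_fourier_psi1_le (η : ℝ) : ‖𝓕 (fun x ↦ ((psi1 x : ℝ) : ℂ)) η‖ ≤ ∫ x, psi1 x := by
  refine (norm_fourier_le_integral_norm _ _).trans (le_of_eq ?_)
  refine integral_congr_ae (Eventually.of_forall fun u ↦ ?_)
  simp only [Complex.norm_real, Real.norm_eq_abs, abs_of_nonneg (psi1_nonneg u)]

/-- **`|f̂_B(ξ)| ≤ ‖ψ₁‖₁ ∫ g_W`** for all `ξ`. [cite: GuthMaynard2026, Lemma 8.4] -/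
theorem norm_fourier_fB_le (hB : 0 < B) (ξ : ℝ) :
    ‖𝓕 (fun x ↦ ((fB W B x : ℝ) : ℂ)) ξ‖ ≤ (∫ x, psi1 x) * ∫ u, gW W u := by
  rw [fourier_fB_eq W hB, norm_mul]
  exact mul_le_mul (norm_fourier_psi1_le _) (norm_fourier_gW_le W ξ) (norm_nonneg _) integral_psi1_pos.le

/-- **Guth–Maynard Lemma 8.4 (Fourier decay of smoothenings of `R`)**, in the form used for
Proposition 9.1: for every `j` there is `C` (depending only on `ψ₁` and `j`) with
`|f̂_B(ξ)| ≤ C (B/|ξ|)^j ∫ g_W` for all finite `W`, all `B > 0` and `ξ ≠ 0` ("`f̂₁(ξ) ⪅_j |W|²B^j/(1+|ξ|)^j`").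
[cite: GuthMaynard2026, Lemma 8.4] -/
theorem norm_fourier_fB_le_decay (j : ℕ) : ∃ C, 0 ≤ C ∧ ∀ (W : Finset ℝ) (B : ℝ), 0 < B → ∀ ξ : ℝ, ξ ≠ 0 →
    ‖𝓕 (fun x ↦ ((fB W B x : ℝ) : ℂ)) ξ‖ ≤ C * (B / |ξ|) ^ j * ∫ u, gW W u := by
  have hψc : ContDiff ℝ ∞ (fun x ↦ ((psi1 x : ℝ) : ℂ)) := Complex.ofRealCLM.contDiff.comp psi1_contDiff
  have hψs : HasCompactSupport (fun x ↦ ((psi1 x : ℝ) : ℂ)) := psi1_hasCompactSupport.comp_left Complex.ofReal_zero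
  obtain ⟨K, hK0, -, hKd⟩ := fourier_decay hψc hψs j
  refine ⟨K, hK0, fun W B hB ξ hξ ↦ ?_⟩
  rw [fourier_fB_eq W hB, norm_mul]
  have hη : ξ / B ≠ 0 := div_ne_zero hξ hB.ne'
  have h1 := hKd (ξ / B) hη
  have h2 : K / |ξ / B| ^ j = K * (B / |ξ|) ^ j := by
    rw [abs_div, abs_of_pos hB, div_pow, div_pow]
    field_simp
  rw [h2] at h1
  exact mul_le_mul h1 (norm_fourier_gW_le W ξ) (norm_nonneg _) (by positivity)

end fourier

end GuthMaynardSmoothR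

end Literature.NumberTheory.LFunctions

end
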